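import Literature.NumberTheory.EllipticCurves.ModularCurve
import Literature.NumberTheory.EllipticCurves.QuadraticTwist
import Literature.NumberTheory.EllipticCurves.Isogeny
import Literature.NumberTheory.EllipticCurves.GlobalMinimalModel
import Literature.NumberTheory.DiophantineGeometry.Conductor
import HarnessLib
import HarnessLib.Audit.Tags

/-!
# Candidates E-an-8 (i) / (ii) (theorem targets): the `−1`-TWIST LATTICE ROTATION and RIGIDITY at `2`
# (`MinusOneTwistLatticeRotation`, `MinusOneTwistRigidity`)
# — cell `bsd-f2-manin` (D-0131 (3) frontier: the Manin constant at additive primes). `@[conjecture]`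
# leaf (NOTHING asserted; definitions only).

HONEST FRAMING. LENS = analytic / period-lattice (planner `bsd-f2-manin-an` g1, HOME
`run/shared/lean/pub/bsd-f2-manin/MEMO-an.md` PART II §17), Props VERBATIM from HOME/an/Sketch-an2.lean
(sha16 592a983c0c28c202; audited copy HOME/ref1-C8-an-g1.lean) with `IsLatticeOptimal D` inlined as the
lattice clause `Λ_W = c·Λ_f`. MECHANISM (memo §9): for `16 ∣ N`, `f|τ_4 = i · (f ⊗ χ₋₄)` with `τ_4` in the
normaliser of `Γ₀(N)` (Atkin–Lehner 1970), hence `Λ_f = i · Λ_{f⊗χ₋₄}` for a twist at the same level (E-an-8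
(i)); with the local lemma «the `−1`-twist does not move `v₂(Δ_min)` for `2⁵ ∣ N`» (E-an-8 (loc), IN PRINT —
Pal 2012 Prop. 2.4 2(b)(iii) per refuter-2 — NOT typed here; it is a Literature fact for the proof, not a
leaf) this gives E-an-8 (ii): the twist of the optimal curve is optimal, `deg` is flat (= the imc leaf
`MinusOneTwistFlat` on `2⁵ ∣ N`, distinct classes) and `c′ = ± c` EXACTLY.

THE ROWS. E-an-8 (i) `MinusOneTwistLatticeRotation` (support, THEOREM TARGET): `2⁴ ∣ N`, `W′ ~ W ⊗ χ₋₄` at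
the same conductor ⇒ `Λ_{f′} = i⁻¹ · Λ_f` (as `z ∈ Λ_{f′} ↔ i·z ∈ Λ_f`). E-an-8 (ii) `MinusOneTwistRigidity`
(THEOREM TARGET from (i) + (loc)): `2⁵ ∣ N`, optimal data of a `−1`-twist pair at the same conductor, classes
distinct ⇒ `W′ ≅_ℚ W ⊗ χ₋₁`, `deg φ_{D′} = deg φ_D` and `c(D′) = ± c(D)`. BC5 WITNESS (memo §17, HOME/an/g1-
twist16*.out, N < 5·10⁵): (ii) 148 277 pairs, 0 exceptions; (loc) 453 178 curves with `v₂(N) ∈ {5,6,7,8}`,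
0 exceptions; for `v₂(N) = 4` the twist never has conductor `N` (so the `2⁴` binder of (i) equals the `2⁵`
habitat vacuously). Refuter verdicts: REF1 **E-an-8 (i), (loc), (ii) SURVIVE** 2026-08-27T16:22Z
(HOME/REFUTER-ref1.md §R4: rc 0, BC7 CLEAN; engine: 296 554 / 296 554 same-conductor `(2, −1)` rows at
`v₂N ∈ {5,6,7,8}` commute / flat; `f|τ₄ = i·(f⊗χ₋₄)` checked on paper); REF2 (HOME/REFUTER-ref2.md, v3
§C″, F10): (i) IN-PRINT-IMPLICIT (`τ₄ ∈ Norm ⟺ 16 ∣ N`, Atkin–Lehner 1970), (loc) IN PRINT, (ii) `c′ = ±c`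
for `32 ∣ N` NOT-IN-PRINT, FOLKLORE-PROVABLE ⇒ beyond-print THEOREM candidate (the first `c`-statement of the
cell that is a theorem, not a law; kills the `(2, χ₋₄)` instance of the imc leaf `RamifiedTwistManinInvariance`).
The planner's g2 row E-an-10 supersedes (ii) as the statement of record once audited (MEMO-an PART III).
-/

noncomputable section

open scoped MatrixGroups ModularForm

open CongruenceSubgroup WeierstrassCurve
  Literature.NumberTheory.EllipticCurves Literature.NumberTheory.EllipticCurves.ModularForms

namespace Summit.BirchSwinnertonDyer.Rank1Residual.ManinAdditive

/-- **E-an-8 (i) `MinusOneTwistLatticeRotation` (cell bsd-f2-manin; support THEOREM TARGET — the exact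
form of Stevens' `η = 2` inclusion at conductor exponent `≥ 4`; in print only implicitly; nothing asserted):**
`2⁴ ∣ N`, `W′ ~ W ⊗ χ₋₄` at the same conductor, data `D`, `D′` at the conductor levels:
`z ∈ Λ_{f′} ↔ i·z ∈ Λ_f` (from `f|τ_4 = i·f′`, `f′|τ_4 = i·f`).
[cite: Stevens1989, Lemma (5.4) p. 97 (the Gauss-sum inclusion; the exact rotation at 16 ∣ N is NOT stated
in print — cell bsd-f2-manin MEMO-an.md §17, E-an-8 (i))] -/
@[conjecture] def MinusOneTwistLatticeRotation : Prop :=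
  ∀ (W W' : WeierstrassCurve ℚ) [W.IsElliptic] [W.IsGloballyMinimal] [W'.IsElliptic]
    [W'.IsGloballyMinimal] [NeZero (W.conductorNorm ℤ)] [NeZero (W'.conductorNorm ℤ)]
    (D : ModularParametrizationData W (W.conductorNorm ℤ))
    (D' : ModularParametrizationData W' (W'.conductorNorm ℤ)),
    2 ^ 4 ∣ W.conductorNorm ℤ → W'.conductorNorm ℤ = W.conductorNorm ℤ →
    IsIsogenous (W.quadraticTwist ((-1 : ℤ) : ℚ)) W' →
    ∀ z : ℂ, z ∈ periodLattice D'.f ↔ Complex.I * z ∈ periodLattice D.f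

/-- **E-an-8 (ii) `MinusOneTwistRigidity` (cell bsd-f2-manin; THEOREM TARGET from (i) + the in-print local
lemma at 2; NOT in print; nothing asserted):** `2⁵ ∣ N`, optimal data of a `−1`-twist pair at the same
conductor, classes distinct: `W′ ≅_ℚ W ⊗ χ₋₁` (the twist of the optimal curve is optimal), `deg φ_{D′} = deg φ_D`
and `c(D′) = ± c(D)`.
[cite: Stevens1989, Lemma (5.4) p. 97 (shape only; the rigidity statement with c′ = ±c is NOT in print — cell
bsd-f2-manin MEMO-an.md §17, E-an-8 (ii))] -/
@[conjecture] def MinusOneTwistRigidity : Prop :=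
  ∀ (W W' : WeierstrassCurve ℚ) [W.IsElliptic] [W.IsGloballyMinimal] [W'.IsElliptic]
    [W'.IsGloballyMinimal] [NeZero (W.conductorNorm ℤ)] [NeZero (W'.conductorNorm ℤ)]
    (D : ModularParametrizationData W (W.conductorNorm ℤ))
    (D' : ModularParametrizationData W' (W'.conductorNorm ℤ)),
    (∀ z ∈ D.L.lattice, ∃ w ∈ periodLattice D.f, z = D.c * w) →
    (∀ z ∈ D'.L.lattice, ∃ w ∈ periodLattice D'.f, z = D'.c * w) →
    2 ^ 5 ∣ W.conductorNorm ℤ → W'.conductorNorm ℤ = W.conductorNorm ℤ →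
    IsIsogenous (W.quadraticTwist ((-1 : ℤ) : ℚ)) W' →
    ¬ IsIsogenous W W' →
    (∃ C : VariableChange ℚ, C • W.quadraticTwist ((-1 : ℤ) : ℚ) = W') ∧
    D'.modularDegree = D.modularDegree ∧ (D'.c = D.c ∨ D'.c = -D.c)

end Summit.BirchSwinnertonDyer.Rank1Residual.ManinAdditive

end
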